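import Literature.NumberTheory.GaloisRepresentations.IndexCoprimeTransfer
import HarnessLib

/-!
# Shapiro's lemma: the Shapiro map is injective on classes (Serre I §2.5 Prop. 10)

For a closed subgroup `S` of a profinite group `G` and a discrete `S`-module `A`, the Shapiro map
`sh : H^q(G, M_G^S(A)) → H^q(S, A)` induced by "valeur au point `1`" (Serre, *Cohomologie
galoisienne*, I §2.5 Prop. 10; Shatz II §2 Thm. 8) is an isomorphism.  The tree has its
surjectivity (a retraction, `CohomologicalDimensionProofs.lean`) and the transfer of vanishing
(`ShapiroVanishing.lean`).  This file proves **injectivity on classes**, at cochain level and by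
the same dimension shifting as `ShapiroVanishing.lean`:

* `exists_d_eq_of_sh_eq_d` — a cocycle of `G` with values in `M_G^S(A)` whose image under the
  Shapiro cochain map is a coboundary is a coboundary (all degrees `≥ 1`);
* `map_shapiro_eq_zero_imp` — the class-level statement `sh y = 0 ⇒ y = 0`.

Consequence, with the unit `M → M_G^S(M)` and the norm `M_G^S(M) → M` of
`IndexCoprimeTransfer.lean` (Serre I §2.4 Prop. 9, `Cor ∘ Res = (G : S)`): for an **open**
subgroup `S` of index `m` and any discrete `G`-module `M`,

* `index_smul_eq_zero_of_res_eq_zero` — a class `x ∈ H^{n+1}(G, M)` whose restriction to `S`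
  vanishes satisfies `m • x = 0`;
* `eq_zero_of_res_eq_zero_of_psmul_eq_zero` — if moreover `p ^ r • x = 0` with `p ∤ m`, then
  `x = 0` ("Res est injectif sur les composantes `p`-primaires", Serre I §3.3, proof of
  Prop. 14 / Cor. 1, for open subgroups).

These are the class-level forms needed when the coefficient module is not `p`-primary (e.g.
`K̄ˣ` in the Kummer sequence), on the way to Serre II §3.1 Prop. 5 for
`Literature.NumberTheory.GaloisRepresentations.tsen_fieldCdLE_one_of_trdeg_eq_one`.

## References

* J.-P. Serre, *Cohomologie galoisienne*, 5e éd., LNM 5 (1994) / *Galois Cohomology* (1997),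
  I §2.4 Prop. 9, I §2.5 Prop. 10, I §3.3 Prop. 14 and Cor. 1. [SerreGaloisCohomology1997]
* S. S. Shatz, *Profinite groups, arithmetic, and geometry* (1972), Ch. II §2 Thm. 8, §4.
  [Shatz1972]
-/

noncomputable section

open CategoryTheory Topology Set

universe u

namespace Literature.NumberTheory.GaloisRepresentations

open _root_.TopRep _root_.ContRepresentation _root_.ContinuousCohomology

set_option allowUnsafeReducibility true in
attribute [local reducible] CategoryTheory.Functor.mapHomologicalComplex

/-! ### A clean-index form of the vanishing criterion -/

section Helper

variable {k : Type*} [Ring k] [TopologicalSpace k]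
variable {G : Type u} [Group G] [TopologicalSpace G] [IsTopologicalGroup G]

/-- `Hʲ(G, X) = 0` in the form "every `j`-cocycle is a coboundary", with the degrees `i, j, l`
supplied as numerals related by `j = i + 1`, `l = j + 1` (this keeps later rewriting purely
syntactic; cf. `subsingleton_homology_succ_iff`). [folklore] -/
theorem exists_d_eq_of_subsingleton {X : TopRep k G} {i j l : ℕ} (hj : j = i + 1) (hl : l = j + 1)
    (h : Subsingleton (continuousCohomology j X)) (x : (homogeneousCochains X).X j)
    (hx : (homogeneousCochains X).d j l x = 0) :
    ∃ y : (homogeneousCochains X).X i, (homogeneousCochains X).d i j y = x := by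
  subst hj; subst hl
  exact (subsingleton_homology_succ_iff _ i).1 h x hx

/-- A morphism of complexes of topological modules kills `0` (stated once over a generic
coefficient ring, for purely syntactic rewriting later). [folklore] -/
theorem hom_f_apply_zero {K L : CochainComplex (TopModuleCat k) ℕ} (φ : K ⟶ L) (i : ℕ) :
    φ.f i (0 : K.X i) = 0 :=
  map_zero _

end Helper

/-! ### The Shapiro cochain map and its naturality -/

section ShMap

variable {G : Type u} [Group G] [TopologicalSpace G] [IsTopologicalGroup G] [CompactSpace G]
variable {S : Subgroup G}
variable {A₁ : Type u} [AddCommGroup A₁] [TopologicalSpace A₁] [DiscreteTopology A₁]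
variable {A₂ : Type u} [AddCommGroup A₂] [TopologicalSpace A₂] [DiscreteTopology A₂]

/-- The **Shapiro cochain map** `C•(G, M_G^S(A)) → C•(S, A)`: Mathlib's `cochainsMap` of the
pair (`S ↪ G`, "valeur au point `1`" `coindEvalOne`). [cite: SerreGaloisCohomology1997, I §2.5] -/
abbrev shCochains (σ : ContinuousRep S ℤ A₁) :
    homogeneousCochains (coindRep σ).toTopRep ⟶ homogeneousCochains σ.toTopRep :=
  cochainsMap (subgroupIncl S) (coindEvalOne σ)

/-- Naturality of the Shapiro map in the module, on the terms of the resolutions: evaluation at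
`1` commutes with post-composition by a morphism `f : A₁ → A₂`. [folklore] -/
theorem resolutionMap_coindMap {σ₁ : ContinuousRep S ℤ A₁} {σ₂ : ContinuousRep S ℤ A₂}
    (f : σ₁.toTopRep ⟶ σ₂.toTopRep) :
    ∀ (m : ℕ) (w : resolutionX (coindRep σ₁).toTopRep m),
      (resolutionMap (subgroupIncl S) (coindEvalOne σ₂) m).hom
          ((resolutionHom (coindMap f) m).hom w) =
        (resolutionHom f m).hom ((resolutionMap (subgroupIncl S) (coindEvalOne σ₁) m).hom w)
  | 0, _ => rfl
  | m + 1, F => by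
    ext x : 1
    exact resolutionMap_coindMap f m _

/-- **Naturality of the Shapiro cochain map**: `sh ∘ C(M_G^S(f)) = C(f) ∘ sh`. [folklore] -/
theorem shCochains_cochainsHom {σ₁ : ContinuousRep S ℤ A₁} {σ₂ : ContinuousRep S ℤ A₂}
    (f : σ₁.toTopRep ⟶ σ₂.toTopRep) (i : ℕ) (y : (homogeneousCochains (coindRep σ₁).toTopRep).X i) :
    (shCochains σ₂).f i ((cochainsHom (coindMap f)).f i y) =
      (cochainsHom f).f i ((shCochains σ₁).f i y) :=
  Subtype.ext (resolutionMap_coindMap f (i + 1) y.1)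

/-- The Shapiro cochain map on a `0`-cochain, evaluated: `(sh v)(s) = (v s)(1)`. [folklore] -/
theorem shCochains_zero_apply (σ : ContinuousRep S ℤ A₁)
    (v : (homogeneousCochains (coindRep σ).toTopRep).X 0) (s : S) :
    ((((shCochains σ).f 0 v : (homogeneousCochains σ.toTopRep).X 0) : resolutionX σ.toTopRep 1) :
      C(S, A₁)) s = ((v.1 : C(G, coindModule σ)) (s : G) : C(G, A₁)) 1 := rfl

end ShMap

/-! ### Injectivity of the Shapiro map on classes -/

section Injective

variable {G : Type u} [Group G] [TopologicalSpace G] [IsTopologicalGroup G] [CompactSpace G]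
  [T2Space G] [TotallyDisconnectedSpace G]
variable {S : Subgroup G} [hS : IsClosed (S : Set G)]

attribute [local instance] compactSpace_of_isClosed_subgroup

-- In the chases below the dimension-shifting modules `C(S, A)` and `Q = C(S, A)/A` and the maps
-- between them are first given short names (`τI`, `τQ`, `ι`, `π`) with their types spelled out
-- over the subtype `{x // x ∈ S}` (this keeps all universe levels determined).  Two steps remain
-- expensive for the unifier (comparing values of `0`-cochains of `M_G^S(Q)` at a point, and
-- transporting the acyclicity of `C(S, A)` to the renamed module), whence the raised heartbeats.
set_option maxHeartbeats 800000 in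
/-- **Shapiro injectivity in degree one, cochain level**: a homogeneous `1`-cocycle `y` of `G` with
values in `M_G^S(A)` such that `sh y` is a coboundary is a coboundary.  The obstruction is an
`S`-invariant `q` of `Q = C(S, A)/A` (`coindRep_mem_invariants_iff`), and the `S`-side datum
shows that `q` lifts to `C(S, A)^S`. [cite: SerreGaloisCohomology1997, I §2.5 Prop. 10] -/
theorem exists_d_eq_of_sh_eq_d_zero {A : Type u} [AddCommGroup A] [TopologicalSpace A]
    [DiscreteTopology A] (σ : ContinuousRep S ℤ A)
    (y : (homogeneousCochains (coindRep (G := G) σ).toTopRep).X 1)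
    (hy : (homogeneousCochains (coindRep (G := G) σ).toTopRep).d 1 2 y = 0)
    (hsh : ∃ z : (homogeneousCochains σ.toTopRep).X 0,
      (homogeneousCochains σ.toTopRep).d 0 1 z = (shCochains (G := G) σ).f 1 y) :
    ∃ b : (homogeneousCochains (coindRep (G := G) σ).toTopRep).X 0,
      (homogeneousCochains (coindRep (G := G) σ).toTopRep).d 0 1 b = y := by
  obtain ⟨z, hz⟩ := hsh
  -- the dimension-shifting data, renamed (see the comment above)
  let τI : ContinuousRep {x : G // x ∈ S} ℤ C({x : G // x ∈ S}, A) := σ.coind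
  let τQ : ContinuousRep {x : G // x ∈ S} ℤ (C({x : G // x ∈ S}, A) ⧸ σ.constSubmodule) :=
    σ.coindQuot
  let ι : σ.toTopRep ⟶ τI.toTopRep := σ.coindι
  let π : τI.toTopRep ⟶ τQ.toTopRep := σ.coindπ
  have hSESS : IsSES ι π := isSES_coind σ
  have hSES : IsSES (coindMap (G := G) ι) (coindMap (G := G) π) := isSES_coindMap hS hSESS
  -- `ι_M y = d b` in the acyclic `M_G^S(C(S, A))`
  have hI1 : Subsingleton (continuousCohomology 1 (coindRep (G := G) τI).toTopRep) :=
    subsingleton_coindRep_coind σ 0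
  have hdy : (homogeneousCochains (coindRep (G := G) τI).toTopRep).d 1 2
      ((cochainsHom (coindMap (G := G) ι)).f 1 y) = 0 := by
    rw [hom_f_d_apply (cochainsHom (coindMap (G := G) ι)) 1 2 y, hy, hom_f_apply_zero]
  obtain ⟨b, hb⟩ := exists_d_eq_of_subsingleton (i := 0) (j := 1) (l := 2) rfl rfl hI1
    ((cochainsHom (coindMap (G := G) ι)).f 1 y) hdy
  -- `v = π_M b` is a `0`-cocycle: a constant with invariant value `w = const q`, `q ∈ Q^S`
  have hv : (homogeneousCochains (coindRep (G := G) τQ).toTopRep).d 0 1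
      ((cochainsHom (coindMap (G := G) π)).f 0 b) = 0 := by
    rw [hom_f_d_apply (cochainsHom (coindMap (G := G) π)) 0 1 b, hb,
      cochainsHom_comp_apply_eq_zero (coindMap (G := G) ι) (coindMap (G := G) π) hSES.comp_eq_zero]
  obtain ⟨w, hw, hvw⟩ := (cochains_d_zero_eq_zero_iff _ _).1 hv
  obtain ⟨q, hq, hwq⟩ := (coindRep_mem_invariants_iff τQ w).1 hw
  -- on the `S`-side: `sh b - ι z` is a `0`-cocycle of `C(S, A)`, a constant `i₀ ∈ C(S, A)^S`
  have hc : (homogeneousCochains τI.toTopRep).d 0 1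
      ((shCochains (G := G) τI).f 0 b - (cochainsHom ι).f 0 z) = 0 := by
    rw [map_sub, hom_f_d_apply (shCochains (G := G) τI) 0 1 b, hb,
      shCochains_cochainsHom (G := G) ι 1 y, hom_f_d_apply (cochainsHom ι) 0 1 z, hz, sub_self]
  obtain ⟨i₀, hi₀, hci₀⟩ := (cochains_d_zero_eq_zero_iff _ _).1 hc
  -- `π i₀ = q`: compare the values at `1 ∈ S` after applying `π`
  have hπi₀ : π.hom i₀ = q := by
    have h1 := congr((($hci₀ : resolutionX τI.toTopRep 1) : C(S, C(S, A))) 1)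
    rw [ContinuousMap.const_apply] at h1
    rw [← h1]
    change π.hom (((((shCochains (G := G) τI).f 0 b : (homogeneousCochains τI.toTopRep).X 0) :
      resolutionX τI.toTopRep 1) : C(S, C(S, A))) 1 -
      ((((cochainsHom ι).f 0 z : (homogeneousCochains τI.toTopRep).X 0) :
        resolutionX τI.toTopRep 1) : C(S, C(S, A))) 1) = q
    rw [map_sub, cochainsHom_f_coe, resolutionHom_succ_hom_apply, resolutionHom_zero_hom_apply,
      show π.hom (ι.hom _) = 0 from congr(($(hSESS.comp_eq_zero)).hom _), sub_zero,
      shCochains_zero_apply]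
    have h2 := congr(((($hvw : resolutionX (coindRep (G := G) τQ).toTopRep 1) :
      C(G, coindModule (G := G) τQ)) ((1 : S) : G) :
        C(G, C({x : G // x ∈ S}, A) ⧸ σ.constSubmodule)) 1)
    rw [ContinuousMap.const_apply, hwq, ContinuousMap.const_apply, cochainsHom_f_coe,
      resolutionHom_succ_hom_apply, resolutionHom_zero_hom_apply, coindMap_hom_coe_apply] at h2
    exact h2
  -- hence `w` lifts to the invariant `const i₀` of `M_G^S(C(S, A))`, and `y` is a coboundary
  have hi₀S : ∀ s : S, τI s i₀ = i₀ := (mem_invariants _).1 hi₀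
  let wI : coindModule (G := G) τI := constCoind τI i₀ hi₀S
  have hwI : wI ∈ (coindRep (G := G) τI).toTopRep.ρ.invariants :=
    (coindRep_mem_invariants_iff τI wI).2 ⟨i₀, hi₀S, rfl⟩
  have hπwI : (coindMap (G := G) π).hom wI = w := by
    apply Subtype.ext
    rw [hwq]
    ext x
    rw [coindMap_hom_coe_apply, ContinuousMap.const_apply]
    exact hπi₀
  -- `b - const wI` maps to `0` under `π_M`, hence is `ι_M a₀`, and `d a₀ = y`
  have h0 : (cochainsHom (coindMap (G := G) π)).f 0 (b - IsSES.zeroCochain _ wI hwI) = 0 := by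
    rw [map_sub, sub_eq_zero]
    apply Subtype.ext
    rw [hvw, cochainsHom_f_coe]
    ext x : 1
    rw [resolutionHom_succ_hom_apply, resolutionHom_zero_hom_apply]
    exact hπwI.symm
  obtain ⟨a₀, ha₀⟩ := cochainsHom_exact_mid _ _ hSES.injective hSES.exact_mid 0 _ h0
  refine ⟨a₀, cochainsHom_injective _ hSES.injective 1 ?_⟩
  rw [← hom_f_d_apply (cochainsHom (coindMap (G := G) ι)) 0 1 a₀, ha₀, map_sub, hb,
    IsSES.d_zeroCochain, sub_zero]

set_option maxHeartbeats 800000 in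
/-- **Shapiro injectivity, inductive step, cochain level**: the statement in degree `n + 2` from
the statement in degree `n + 1` (for all discrete `S`-modules), by dimension shifting along
`0 → A → C(S, A) → Q → 0` and its exact image under `M_G^S` (`isSES_coindMap`), the
`G`-acyclicity of `M_G^S(C(S, A))` (`subsingleton_coindRep_coind`), the `S`-acyclicity of
`C(S, A)` (`subsingleton_coind`) and the naturality of `sh`.
[cite: SerreGaloisCohomology1997, I §2.5 Prop. 10] -/
theorem exists_d_eq_of_sh_eq_d_succ (n : ℕ)
    (IH : ∀ {B : Type u} [AddCommGroup B] [TopologicalSpace B] [DiscreteTopology B]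
      (τ : ContinuousRep S ℤ B) (v : (homogeneousCochains (coindRep τ).toTopRep).X (n + 1)),
      (homogeneousCochains (coindRep τ).toTopRep).d (n + 1) (n + 2) v = 0 →
      (∃ z : (homogeneousCochains τ.toTopRep).X n,
        (homogeneousCochains τ.toTopRep).d n (n + 1) z = (shCochains τ).f (n + 1) v) →
      ∃ e : (homogeneousCochains (coindRep τ).toTopRep).X n,
        (homogeneousCochains (coindRep τ).toTopRep).d n (n + 1) e = v)
    {A : Type u} [AddCommGroup A] [TopologicalSpace A] [DiscreteTopology A]
    (σ : ContinuousRep S ℤ A) (y : (homogeneousCochains (coindRep (G := G) σ).toTopRep).X (n + 2))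
    (hy : (homogeneousCochains (coindRep (G := G) σ).toTopRep).d (n + 2) (n + 3) y = 0)
    (hsh : ∃ z : (homogeneousCochains σ.toTopRep).X (n + 1),
      (homogeneousCochains σ.toTopRep).d (n + 1) (n + 2) z = (shCochains (G := G) σ).f (n + 2) y) :
    ∃ b : (homogeneousCochains (coindRep (G := G) σ).toTopRep).X (n + 1),
      (homogeneousCochains (coindRep (G := G) σ).toTopRep).d (n + 1) (n + 2) b = y := by
  obtain ⟨z, hz⟩ := hsh
  -- the dimension-shifting data, renamed (see the comment above)
  let τI : ContinuousRep {x : G // x ∈ S} ℤ C({x : G // x ∈ S}, A) := σ.coind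
  let τQ : ContinuousRep {x : G // x ∈ S} ℤ (C({x : G // x ∈ S}, A) ⧸ σ.constSubmodule) :=
    σ.coindQuot
  let ι : σ.toTopRep ⟶ τI.toTopRep := σ.coindι
  let π : τI.toTopRep ⟶ τQ.toTopRep := σ.coindπ
  have hSESS : IsSES ι π := isSES_coind σ
  have hSES : IsSES (coindMap (G := G) ι) (coindMap (G := G) π) := isSES_coindMap hS hSESS
  -- `ι_M y = d b`
  have hI : Subsingleton (continuousCohomology (n + 2) (coindRep (G := G) τI).toTopRep) :=
    subsingleton_coindRep_coind σ (n + 1)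
  have hdy : (homogeneousCochains (coindRep (G := G) τI).toTopRep).d (n + 2) (n + 3)
      ((cochainsHom (coindMap (G := G) ι)).f (n + 2) y) = 0 := by
    rw [hom_f_d_apply (cochainsHom (coindMap (G := G) ι)) (n + 2) (n + 3) y, hy, hom_f_apply_zero]
  obtain ⟨b, hb⟩ := exists_d_eq_of_subsingleton (i := n + 1) (j := n + 2) (l := n + 3) rfl rfl hI
    ((cochainsHom (coindMap (G := G) ι)).f (n + 2) y) hdy
  -- `v = π_M b` is a cocycle
  have hv : (homogeneousCochains (coindRep (G := G) τQ).toTopRep).d (n + 1) (n + 2)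
      ((cochainsHom (coindMap (G := G) π)).f (n + 1) b) = 0 := by
    rw [hom_f_d_apply (cochainsHom (coindMap (G := G) π)) (n + 1) (n + 2) b, hb,
      cochainsHom_comp_apply_eq_zero (coindMap (G := G) ι) (coindMap (G := G) π) hSES.comp_eq_zero]
  -- `sh v` is a coboundary: `sh b - ι z` is a cocycle of the `S`-acyclic `C(S, A)`
  have hIS : Subsingleton (continuousCohomology (n + 1) τI.toTopRep) := subsingleton_coind σ n
  have hc : (homogeneousCochains τI.toTopRep).d (n + 1) (n + 2)
      ((shCochains (G := G) τI).f (n + 1) b - (cochainsHom ι).f (n + 1) z) = 0 := by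
    rw [map_sub, hom_f_d_apply (shCochains (G := G) τI) (n + 1) (n + 2) b, hb,
      shCochains_cochainsHom (G := G) ι (n + 2) y, hom_f_d_apply (cochainsHom ι) (n + 1) (n + 2) z,
      hz, sub_self]
  obtain ⟨c, hc'⟩ := exists_d_eq_of_subsingleton (i := n) (j := n + 1) (l := n + 2) rfl rfl hIS
    _ hc
  have hshv : (homogeneousCochains τQ.toTopRep).d n (n + 1) ((cochainsHom π).f n c) =
      (shCochains (G := G) τQ).f (n + 1) ((cochainsHom (coindMap (G := G) π)).f (n + 1) b) := by
    rw [hom_f_d_apply (cochainsHom π) n (n + 1) c, hc', map_sub,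
      cochainsHom_comp_apply_eq_zero ι π hSESS.comp_eq_zero, sub_zero,
      shCochains_cochainsHom (G := G) π (n + 1) b]
  -- induction hypothesis for `Q`: `v = d e`
  obtain ⟨e, he⟩ := IH τQ _ hv ⟨_, hshv⟩
  -- lift and conclude
  obtain ⟨b₀, rfl⟩ := cochainsHom_surjective _ hSES.surjective n e
  have h6 : (cochainsHom (coindMap (G := G) π)).f (n + 1)
      (b - (homogeneousCochains (coindRep (G := G) τI).toTopRep).d n (n + 1) b₀) = 0 := by
    rw [map_sub, ← hom_f_d_apply (cochainsHom (coindMap (G := G) π)) n (n + 1) b₀, he, sub_self]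
  obtain ⟨a₁, ha₁⟩ := cochainsHom_exact_mid _ _ hSES.injective hSES.exact_mid (n + 1) _ h6
  refine ⟨a₁, cochainsHom_injective _ hSES.injective (n + 2) ?_⟩
  rw [← hom_f_d_apply (cochainsHom (coindMap (G := G) ι)) (n + 1) (n + 2) a₁, ha₁, map_sub,
    d_d_apply _ n (n + 1) (n + 2) b₀, sub_zero, hb]

/-- **Shapiro injectivity, cochain level** (Serre I §2.5 Prop. 10; Shatz II Thm. 8): a homogeneous
`(n+1)`-cocycle `y` of `G` with values in `M_G^S(A)` whose image `sh y` in the cochains of `S` with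
values in `A` is a coboundary is itself a coboundary (induction on `n`:
`exists_d_eq_of_sh_eq_d_zero`, `exists_d_eq_of_sh_eq_d_succ`).
[cite: SerreGaloisCohomology1997, I §2.5 Prop. 10]
[cite: Shatz1972, Ch. II §2 Thm. 8 (Faddeev–Shapiro)] -/
theorem exists_d_eq_of_sh_eq_d :
    ∀ (n : ℕ) {A : Type u} [AddCommGroup A] [TopologicalSpace A] [DiscreteTopology A]
      (σ : ContinuousRep S ℤ A)
      (y : (homogeneousCochains (coindRep (G := G) σ).toTopRep).X (n + 1)),
      (homogeneousCochains (coindRep σ).toTopRep).d (n + 1) (n + 2) y = 0 →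
      (∃ z : (homogeneousCochains σ.toTopRep).X n,
        (homogeneousCochains σ.toTopRep).d n (n + 1) z = (shCochains σ).f (n + 1) y) →
      ∃ b : (homogeneousCochains (coindRep σ).toTopRep).X n,
        (homogeneousCochains (coindRep σ).toTopRep).d n (n + 1) b = y
  | 0, _, _, _, _, σ, y, hy, hsh => exists_d_eq_of_sh_eq_d_zero σ y hy hsh
  | n + 1, _, _, _, _, σ, y, hy, hsh =>
    exists_d_eq_of_sh_eq_d_succ n (fun τ v hv hz => exists_d_eq_of_sh_eq_d n τ v hv hz) σ y hy hsh

variable {A : Type u} [AddCommGroup A] [TopologicalSpace A] [DiscreteTopology A]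

/-- **Shapiro injectivity on classes**: for `y ∈ H^{n+1}(G, M_G^S(A))`, `sh y = 0 ⇒ y = 0`, where
`sh = ContinuousCohomology.map (S ↪ G) (coindEvalOne σ)` (Serre I §2.5 Prop. 10, injectivity
half). [cite: SerreGaloisCohomology1997, I §2.5 Prop. 10] -/
theorem map_shapiro_eq_zero_imp (σ : ContinuousRep S ℤ A) (n : ℕ)
    (y : continuousCohomology (n + 1) (coindRep (G := G) σ).toTopRep)
    (hy : (ContinuousCohomology.map (subgroupIncl S) (coindEvalOne σ) (n + 1)).hom y = 0) :
    y = 0 := by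
  obtain ⟨c, hc, rfl⟩ := cxClass_surjective (homogeneousCochains (coindRep σ).toTopRep) (n + 1)
    (n + 2) (up_nat_next (n + 1)) y
  change (HomologicalComplex.homologyMap (shCochains σ) (n + 1)) (cxClass _ (n + 1) (n + 2)
    (up_nat_next (n + 1)) c hc) = 0 at hy
  rw [homologyMap_cxClass (shCochains σ) (n + 1) (n + 2) (up_nat_next (n + 1)) c hc _
    (by rw [hom_f_d_apply (shCochains σ) (n + 1) (n + 2) c, hc, hom_f_apply_zero]) rfl,
    cxClass_eq_zero_iff _ (n + 1) (n + 2) (up_nat_next (n + 1)) n (up_nat_prev_succ n)] at hy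
  rw [cxClass_eq_zero_iff _ (n + 1) (n + 2) (up_nat_next (n + 1)) n (up_nat_prev_succ n)]
  exact exists_d_eq_of_sh_eq_d n σ c hc hy

end Injective

/-! ### Classes killed by restriction to an open subgroup are killed by the index -/

section Index

variable {G : Type u} [Group G] [TopologicalSpace G] [IsTopologicalGroup G] [CompactSpace G]
variable {S : Subgroup G}
variable {M : Type u} [AddCommGroup M] [TopologicalSpace M] [DiscreteTopology M]
variable (ρ : ContinuousRep G ℤ M)

/-- `coindEvalOne ∘ unitCoind = id` on elements: `(x ↦ x a)(1) = a`. [folklore] -/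
theorem coindEvalOne_unitCoind (a : M) :
    (coindEvalOne (ρ.restrict (subgroupIncl S))).hom ((unitCoind (S := S) ρ).hom a) = a := by
  rw [coindEvalOne_apply, unitCoind_hom_coe_apply, map_one, Module.End.one_apply]

/-- The Shapiro map after the unit is the restriction, on the terms of the resolutions.
[folklore] -/
theorem resolutionMap_unitCoind :
    ∀ (m : ℕ) (w : resolutionX ρ.toTopRep m),
      (resolutionMap (subgroupIncl S) (coindEvalOne (ρ.restrict (subgroupIncl S))) m).hom
          ((resolutionHom (unitCoind (S := S) ρ) m).hom w) =
        (resolutionMap (subgroupIncl S) (𝟙 ((ρ.restrict (subgroupIncl S)).toTopRep)) m).hom w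
  | 0, w => coindEvalOne_unitCoind ρ w
  | m + 1, F => by
    ext x : 1
    exact resolutionMap_unitCoind m _

omit [CompactSpace G] in
/-- A morphism of modules acting as multiplication by `m` acts as multiplication by `m` on the
terms of the resolutions. [folklore] -/
theorem resolutionHom_eq_nsmul {M' : Type u} [AddCommGroup M'] [TopologicalSpace M']
    [DiscreteTopology M'] {ρ' : ContinuousRep G ℤ M'} (f : ρ'.toTopRep ⟶ ρ'.toTopRep) (m : ℕ)
    (hf : ∀ v, f.hom v = m • v) :
    ∀ (i : ℕ) (w : resolutionX ρ'.toTopRep i), (resolutionHom f i).hom w = m • w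
  | 0, w => hf w
  | i + 1, F => by
    ext x : 1
    rw [resolutionHom_succ_hom_apply, resolutionHom_eq_nsmul f m hf i]
    rfl

omit [CompactSpace G] in
/-- `resolutionHom` is functorial, on elements. [folklore] -/
theorem resolutionHom_comp_apply {M₁ M₂ M₃ : Type u} [AddCommGroup M₁] [TopologicalSpace M₁]
    [DiscreteTopology M₁] [AddCommGroup M₂] [TopologicalSpace M₂] [DiscreteTopology M₂]
    [AddCommGroup M₃] [TopologicalSpace M₃] [DiscreteTopology M₃] {ρ₁ : ContinuousRep G ℤ M₁}
    {ρ₂ : ContinuousRep G ℤ M₂} {ρ₃ : ContinuousRep G ℤ M₃} (f : ρ₁.toTopRep ⟶ ρ₂.toTopRep)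
    (g : ρ₂.toTopRep ⟶ ρ₃.toTopRep) :
    ∀ (i : ℕ) (w : resolutionX ρ₁.toTopRep i),
      (resolutionHom (f ≫ g) i).hom w = (resolutionHom g i).hom ((resolutionHom f i).hom w)
  | 0, _ => rfl
  | i + 1, F => by
    ext x : 1
    exact resolutionHom_comp_apply f g i _

omit [CompactSpace G] in
/-- `cochainsHom` is functorial, on elements. [folklore] -/
theorem cochainsHom_comp_apply' {M₁ M₂ M₃ : Type u} [AddCommGroup M₁] [TopologicalSpace M₁]
    [DiscreteTopology M₁] [AddCommGroup M₂] [TopologicalSpace M₂] [DiscreteTopology M₂]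
    [AddCommGroup M₃] [TopologicalSpace M₃] [DiscreteTopology M₃] {ρ₁ : ContinuousRep G ℤ M₁}
    {ρ₂ : ContinuousRep G ℤ M₂} {ρ₃ : ContinuousRep G ℤ M₃} (f : ρ₁.toTopRep ⟶ ρ₂.toTopRep)
    (g : ρ₂.toTopRep ⟶ ρ₃.toTopRep) (i : ℕ) (y : (homogeneousCochains ρ₁.toTopRep).X i) :
    (cochainsHom (f ≫ g)).f i y = (cochainsHom g).f i ((cochainsHom f).f i y) :=
  Subtype.ext (resolutionHom_comp_apply f g (i + 1) y.1)

variable [T2Space G] [TotallyDisconnectedSpace G]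

/-- **A cocycle whose restriction to an open subgroup is a coboundary becomes a coboundary after
multiplication by the index** (Serre I §2.4 Prop. 9 `Cor ∘ Res = n`, through the induced module:
`sh (unit a) = res a`, so `unit a` is a coboundary by Shapiro injectivity, and
`norm (unit a) = (G : S) a`). [cite: SerreGaloisCohomology1997, I §2.4 Prop. 9]
[cite: SerreGaloisCohomology1997, I §2.5 Prop. 10] -/
theorem exists_d_eq_index_smul_of_res_eq_d (hS : IsOpen (S : Set G)) (n : ℕ)
    (a : (homogeneousCochains ρ.toTopRep).X (n + 1))
    (ha : (homogeneousCochains ρ.toTopRep).d (n + 1) (n + 2) a = 0)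
    (hres : ∃ z : (homogeneousCochains (ρ.restrict (subgroupIncl S)).toTopRep).X n,
      (homogeneousCochains (ρ.restrict (subgroupIncl S)).toTopRep).d n (n + 1) z =
        (cochainsMap (subgroupIncl S) (𝟙 ((ρ.restrict (subgroupIncl S)).toTopRep))).f (n + 1) a) :
    ∃ e : (homogeneousCochains ρ.toTopRep).X n,
      (homogeneousCochains ρ.toTopRep).d n (n + 1) e = (S.index : ℤ) • a := by
  haveI : IsClosed (S : Set G) := Subgroup.isClosed_of_isOpen S hS
  haveI : Finite (G ⧸ S) := Subgroup.quotient_finite_of_isOpen S hS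
  letI : Fintype (G ⧸ S) := Fintype.ofFinite _
  obtain ⟨z, hz⟩ := hres
  -- `unit a` is a cocycle with `sh (unit a) = res a = d z`, hence a coboundary
  have hua : (homogeneousCochains (coindRep (ρ.restrict (subgroupIncl S))).toTopRep).d (n + 1)
      (n + 2) ((cochainsHom (unitCoind (S := S) ρ)).f (n + 1) a) = 0 := by
    rw [hom_f_d_apply (cochainsHom (unitCoind (S := S) ρ)) (n + 1) (n + 2) a, ha, hom_f_apply_zero]
  have hsh : (shCochains (ρ.restrict (subgroupIncl S))).f (n + 1)
      ((cochainsHom (unitCoind (S := S) ρ)).f (n + 1) a) =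
      (cochainsMap (subgroupIncl S) (𝟙 ((ρ.restrict (subgroupIncl S)).toTopRep))).f (n + 1) a :=
    Subtype.ext (resolutionMap_unitCoind ρ (n + 2) a.1)
  obtain ⟨e₁, he₁⟩ := exists_d_eq_of_sh_eq_d n (ρ.restrict (subgroupIncl S)) _ hua
    ⟨z, by rw [hz, hsh]⟩
  -- `norm (unit a) = (G : S) • a`
  refine ⟨(cochainsHom (normCoind ρ)).f n e₁, ?_⟩
  rw [hom_f_d_apply (cochainsHom (normCoind ρ)) n (n + 1) e₁, he₁, ← cochainsHom_comp_apply']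
  apply Subtype.ext
  rw [cochainsHom_f_coe, resolutionHom_eq_nsmul (unitCoind (S := S) ρ ≫ normCoind ρ) S.index
    (fun v => by
      change (normCoind ρ).hom ((unitCoind (S := S) ρ).hom v) = S.index • v
      rw [normCoind_unitCoind, Subgroup.index_eq_card, Nat.card_eq_fintype_card]) (n + 2) a.1,
    ← natCast_zsmul]
  rfl

omit [CompactSpace G] [T2Space G] [TotallyDisconnectedSpace G] in
/-- Bezout: `m • a = d e`, `p ^ r • a = 0`, `p ∤ m` give `a = d (A • e)`. [folklore] -/
theorem exists_d_eq_of_coprime {p m r : ℕ} (hmp : m.Coprime p) {i j : ℕ}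
    (a : (homogeneousCochains ρ.toTopRep).X j) (e : (homogeneousCochains ρ.toTopRep).X i)
    (hm : (homogeneousCochains ρ.toTopRep).d i j e = (m : ℤ) • a)
    (hp : ((p : ℤ) ^ r) • a = 0) :
    ∃ b : (homogeneousCochains ρ.toTopRep).X i, (homogeneousCochains ρ.toTopRep).d i j b = a := by
  have h1 : ((m : ℤ) * Nat.gcdA m (p ^ r) + ((p ^ r : ℕ) : ℤ) * Nat.gcdB m (p ^ r)) = 1 := by
    rw [← Nat.gcd_eq_gcd_ab, (Nat.Coprime.pow_right r hmp).gcd_eq_one, Nat.cast_one]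
  refine ⟨Nat.gcdA m (p ^ r) • e, ?_⟩
  rw [map_zsmul, hm]
  calc Nat.gcdA m (p ^ r) • (m : ℤ) • a
      = Nat.gcdA m (p ^ r) • (m : ℤ) • a + Nat.gcdB m (p ^ r) • ((p : ℤ) ^ r) • a := by
        rw [hp, smul_zero, add_zero]
    _ = ((m : ℤ) * Nat.gcdA m (p ^ r) + ((p ^ r : ℕ) : ℤ) * Nat.gcdB m (p ^ r)) • a := by
        rw [add_smul, mul_comm (m : ℤ), mul_smul, mul_comm ((p ^ r : ℕ) : ℤ), mul_smul,
          Nat.cast_pow]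
    _ = a := by rw [h1, one_smul]

/-- **Restriction to an open subgroup of index prime to `p` is injective on cocycles killed by a
power of `p`** (Serre I §3.3, proof of Prop. 14 / Cor. 1: "Res est injectif sur les composantes
`p`-primaires"; here for an open subgroup, any discrete module, cochain level): if the
restriction of the cocycle `a` to `S` is a coboundary and `p ^ r • a = 0`, then `a` is a
coboundary. [cite: SerreGaloisCohomology1997, I §3.3 Prop. 14 and Cor. 1]
[cite: SerreGaloisCohomology1997, I §2.4 Prop. 9] -/
theorem exists_d_eq_of_res_eq_d_of_psmul_eq_zero {p r : ℕ} (hS : IsOpen (S : Set G))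
    (hcop : S.index.Coprime p) (n : ℕ) (a : (homogeneousCochains ρ.toTopRep).X (n + 1))
    (ha : (homogeneousCochains ρ.toTopRep).d (n + 1) (n + 2) a = 0)
    (hres : ∃ z : (homogeneousCochains (ρ.restrict (subgroupIncl S)).toTopRep).X n,
      (homogeneousCochains (ρ.restrict (subgroupIncl S)).toTopRep).d n (n + 1) z =
        (cochainsMap (subgroupIncl S) (𝟙 ((ρ.restrict (subgroupIncl S)).toTopRep))).f (n + 1) a)
    (hp : ((p : ℤ) ^ r) • a = 0) :
    ∃ b : (homogeneousCochains ρ.toTopRep).X n,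
      (homogeneousCochains ρ.toTopRep).d n (n + 1) b = a := by
  obtain ⟨e, he⟩ := exists_d_eq_index_smul_of_res_eq_d ρ hS n a ha hres
  exact exists_d_eq_of_coprime ρ hcop a e he hp

end Index

end Literature.NumberTheory.GaloisRepresentations

end
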